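import Literature.Analysis.FluidPDE.LocalBiotSavartLog
import HarnessLib

/-!
# A scale-free pointwise Biot–Savart bound for divergence-free fields

Analysis/FluidPDE support file (theorems only, no definitions, no named facts) on the discharge
path of the named fact `Literature.Analysis.FluidPDE.wangYang2026_liouville_vorticity_log`
(`SteadyNSLiouville.lean`; W. Wang, G. Yang, arXiv:2608.06040, **Theorem 1.6**: a steady
`D`-solution of Navier–Stokes on `ℝ³` whose vorticity satisfies
`sup_{|x'|=r} |ω| ≤ C r^{-5/3} [log(e+r)]^{-γ}`, `γ > 1/3`, is trivial). The first step of the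
printed proof (Prop. 4.2, p. 21) transfers the vorticity decay to the velocity through the
Biot–Savart bound `|u(x)| ≤ C ∫ |ω(y)| |x − y|⁻² dy` (Lemma 2.3 (i), (2.7), p. 8), obtained there
from the distributional identity `u = curl (−Δ)⁻¹ ω` for `D`-solutions (Sobolev `u ∈ L⁶` and the
Liouville theorem for `L⁶` harmonic fields). Here the same bound is proved **locally and without
any integrability hypothesis**, from the tree's local Biot–Savart law (`LocalBiotSavart.lean`,
Tao 2011 §10: on `B(c, r)`, `uₘ = -(∂ₘ₊₁N[ψωₘ₊₂] - ∂ₘ₊₂N[ψωₘ₊₁]) + Λ[ψuₘ]` with `N` the truncated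
Newtonian potential at radii `(r/2, r)` and `Λ` the smoothing by `λ_r = Δ((1-θ)Γ)`):

* `exists_enorm_le_lintegral_curl_add` — there is an absolute constant `C` such that for every
  smooth divergence-free `u : ℝ³ → ℝ³`, every `x` and every `r > 0`,
  `‖u(x)‖ ≤ C ∫_{B(x,r)} |x − y|⁻² ‖curl u(y)‖ dy + C r⁻³ ∫_{B(x,2r)} ‖u(y)‖ dy`
  (in `ℝ≥0∞`; the derivative `∂ₐN[g]` is the absolutely convergent gradient potential
  `∫ ∂ₐΓ₀(x − y) g(y) dy`, `fderiv_newtonNearPotential_eq_newtonNearGradPotential`, with the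
  scale-free kernel bound `|∂ₐΓ₀^{r/2,r}(z)| ≤ C₁‖a‖|z|⁻²`, `abs_newtonNearGrad_half_le`, and
  `|λ_r| ≤ M r⁻³`, `abs_newtonFarLaplacian_half_le`);
* `exists_enorm_le_lintegral_curl_of_tendsto` — letting `r → ∞` for a field tending to `0` at
  infinity: `‖u(x)‖ ≤ C ∫_{ℝ³} |x − y|⁻² ‖curl u(y)‖ dy` — Wang–Yang's (2.7) for every smooth
  divergence-free field vanishing at infinity (the right-hand side may be infinite).

## References

* W. Wang, G. Yang, *New decay estimates and Liouville type theorems for the 3D axisymmetric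
  stationary Navier–Stokes equations*, arXiv:2608.06040 (2026), Lemma 2.3 (i) and (2.7), p. 8.
  [WangYang2026]
* T. Tao, *Localisation and compactness properties of the Navier–Stokes global regularity
  problem*, arXiv:1108.1165, §10, proof of Thm. 10.1 (local Biot–Savart law). [Tao2011]
* D. Gilbarg, N. S. Trudinger, *Elliptic partial differential equations of second order* (2001),
  (2.16)–(2.17), Lemma 4.1. [GilbargTrudinger2001]
-/

noncomputable section

open MeasureTheory Set Filter Function Metric
open scoped ENNReal NNReal ContDiff Topology

namespace Literature.Analysis.FluidPDE

/-! ### Scale-free kernel bounds at radii `(r/2, r)` -/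

/-- **Scaling of the gradient kernel**: `∂ₐΓ₀^{r/2,r}(z) = r⁻² ∂ₐΓ₀^{1/2,1}(z/r)`
(`Γ₀^{cr₀,cr₁}(z) = c⁻¹Γ₀^{r₀,r₁}(z/c)`, `newtonNear_scale`, and the chain rule). [folklore] -/
theorem newtonNearGrad_half_eq {r : ℝ} (hr : 0 < r) (a z : (EuclideanSpace ℝ (Fin 3))) :
    newtonNearGrad (r / 2) r a z = r⁻¹ ^ 2 * newtonNearGrad (1 / 2) 1 a (r⁻¹ • z) := by
  have hfun : newtonNear (r / 2) r = fun w : (EuclideanSpace ℝ (Fin 3)) => r⁻¹ • newtonNear (1 / 2) 1 (r⁻¹ • w) := by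
    funext w
    have h := newtonNear_scale hr (1 / 2) 1 w
    rw [mul_one, show r * (1 / 2) = r / 2 by ring] at h
    rw [h, smul_eq_mul]
  rw [newtonNearGrad_apply, newtonNearGrad_apply, hfun,
    fderiv_const_smul_comp_smul (newtonNear (1 / 2) 1) r⁻¹ (b := r⁻¹) (inv_ne_zero hr.ne')]
  show (r⁻¹ * r⁻¹) • (fderiv ℝ (newtonNear (1 / 2) 1) (r⁻¹ • z) a) = _
  rw [smul_eq_mul]
  ring

/-- **Scale-free bound for the gradient kernel**: there is an absolute `C₁` with
`|∂ₐΓ₀^{r/2,r}(z)| ≤ C₁ ‖a‖ |z|⁻²` for all `r > 0`, `a`, `z` (both sides vanish at `z = 0`).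
[folklore] -/
theorem abs_newtonNearGrad_half_le :
    ∃ C₁ : ℝ, 0 ≤ C₁ ∧ ∀ ⦃r : ℝ⦄, 0 < r → ∀ a z : (EuclideanSpace ℝ (Fin 3)),
      |newtonNearGrad (r / 2) r a z| ≤ C₁ * ‖a‖ * ‖z‖ ^ (-(2 : ℝ)) := by
  obtain ⟨C, hC0, hC⟩ := exists_abs_newtonNearGrad_le (r₀ := 1 / 2) (r₁ := 1) (by norm_num) (by norm_num)
  refine ⟨C, hC0, fun r hr a z => ?_⟩
  rw [newtonNearGrad_half_eq hr, abs_mul, abs_of_nonneg (by positivity)]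
  have hz : ‖r⁻¹ • z‖ ^ (-(2 : ℝ)) = r ^ (2 : ℝ) * ‖z‖ ^ (-(2 : ℝ)) := by
    rw [norm_smul, Real.norm_eq_abs, abs_of_pos (inv_pos.2 hr),
      Real.mul_rpow (inv_pos.2 hr).le (norm_nonneg _), Real.inv_rpow hr.le, Real.rpow_neg hr.le,
      inv_inv]
  calc r⁻¹ ^ 2 * |newtonNearGrad (1 / 2) 1 a (r⁻¹ • z)|
      ≤ r⁻¹ ^ 2 * (C * ‖a‖ * ‖r⁻¹ • z‖ ^ (-(2 : ℝ))) :=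
        mul_le_mul_of_nonneg_left (hC a _) (by positivity)
    _ = C * ‖a‖ * ‖z‖ ^ (-(2 : ℝ)) := by
        rw [hz, Real.rpow_two]
        field_simp

/-- **Scale-free bound for the smoothing kernel**: there is an absolute `M` with
`|λ_r(z)| ≤ M r⁻³` for all `r > 0` and `z` (`λ_r = r⁻³λ₁(·/r)`, `λ₁` continuous with compact
support). [folklore] -/
theorem abs_newtonFarLaplacian_half_le :
    ∃ M : ℝ, 0 ≤ M ∧ ∀ ⦃r : ℝ⦄, 0 < r → ∀ z : (EuclideanSpace ℝ (Fin 3)),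
      |newtonFarLaplacian (r / 2) r z| ≤ M * r⁻¹ ^ 3 := by
  obtain ⟨M, hM⟩ := (contDiff_lamOne (n := 0)).continuous.bounded_above_of_compact_support
    hasCompactSupport_lamOne
  have hM0 : 0 ≤ M := (norm_nonneg _).trans (hM 0)
  refine ⟨M, hM0, fun r hr z => ?_⟩
  rw [newtonFarLaplacian_half_eq hr]
  dsimp only
  rw [abs_mul, abs_of_nonneg (by positivity), mul_comm]
  refine mul_le_mul_of_nonneg_right ?_ (by positivity)
  rw [← Real.norm_eq_abs]
  exact hM _

/-! ### Pointwise majorants of the two integrands -/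

/-- `|W_b(y)| ≤ ‖curl u(y)‖` for the localised vorticity component `W_b = ψ ω_b`. [folklore] -/
theorem abs_locVort_le (u : (EuclideanSpace ℝ (Fin 3)) → (EuclideanSpace ℝ (Fin 3))) (c : (EuclideanSpace ℝ (Fin 3))) (r : ℝ) (b : Fin 3) (y : (EuclideanSpace ℝ (Fin 3))) :
    |locVort u c r b y| ≤ ‖curl u y‖ := by
  rw [locVort, abs_mul]
  calc |ballCutoff c r y| * |curl u y b| ≤ 1 * |curl u y b| :=
        mul_le_mul_of_nonneg_right (abs_ballCutoff_le_one c r y) (abs_nonneg _)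
    _ = ‖curl u y b‖ := by rw [one_mul, Real.norm_eq_abs]
    _ ≤ ‖curl u y‖ := PiLp.norm_apply_le (curl u y) b

/-- The gradient-potential integrand is dominated by the ball-indicator of
`C₁ |x − y|⁻² ‖curl u(y)‖` (the kernel vanishes for `|x − y| ≥ r`). [folklore] -/
theorem enorm_newtonNearGrad_smul_locVort_le {C₁ : ℝ}
    (hC₁ : ∀ ⦃r : ℝ⦄, 0 < r → ∀ a z : (EuclideanSpace ℝ (Fin 3)), |newtonNearGrad (r / 2) r a z| ≤ C₁ * ‖a‖ * ‖z‖ ^ (-(2 : ℝ)))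
    (u : (EuclideanSpace ℝ (Fin 3)) → (EuclideanSpace ℝ (Fin 3))) {r : ℝ} (hr : 0 < r) (x : (EuclideanSpace ℝ (Fin 3))) (j b : Fin 3) (y : (EuclideanSpace ℝ (Fin 3))) :
    ‖newtonNearGrad (r / 2) r (EuclideanSpace.single j (1 : ℝ)) (x - y) • locVort u x r b y‖ₑ ≤
      (ball x r).indicator
        (fun y => ENNReal.ofReal (C₁ * ‖x - y‖ ^ (-(2 : ℝ))) * ‖curl u y‖ₑ) y := by
  by_cases hy : y ∈ ball x r
  · rw [indicator_of_mem hy, enorm_smul, Real.enorm_eq_ofReal_abs, Real.enorm_eq_ofReal_abs,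
      ← ofReal_norm (curl u y)]
    refine mul_le_mul' (ENNReal.ofReal_le_ofReal ?_) (ENNReal.ofReal_le_ofReal (abs_locVort_le u x r b y))
    have h := hC₁ hr (EuclideanSpace.single j (1 : ℝ)) (x - y)
    have h1 : ‖(EuclideanSpace.single j (1 : ℝ) : (EuclideanSpace ℝ (Fin 3)))‖ = 1 := by simp
    rwa [h1, mul_one] at h
  · rw [indicator_of_notMem hy]
    rw [mem_ball, dist_eq_norm, norm_sub_rev, not_lt] at hy
    rw [newtonNearGrad_eq_zero_of_le (half_pos hr) (half_lt_self hr) _ hy, zero_smul, enorm_zero]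

/-- The smoothing integrand is dominated by the ball-indicator of `M r⁻³ ‖u(y)‖` (the kernel
`λ_r(x − y)` vanishes for `|x − y| > r`). [folklore] -/
theorem enorm_locVel_mul_newtonFarLaplacian_le {M : ℝ}
    (hM : ∀ ⦃r : ℝ⦄, 0 < r → ∀ z : (EuclideanSpace ℝ (Fin 3)), |newtonFarLaplacian (r / 2) r z| ≤ M * r⁻¹ ^ 3)
    (u : (EuclideanSpace ℝ (Fin 3)) → (EuclideanSpace ℝ (Fin 3))) {r : ℝ} (hr : 0 < r) (x : (EuclideanSpace ℝ (Fin 3))) (m : Fin 3) (y : (EuclideanSpace ℝ (Fin 3))) :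
    ‖locVel u x r m y * newtonFarLaplacian (r / 2) r (x - y)‖ₑ ≤
      (ball x (2 * r)).indicator (fun y => ENNReal.ofReal (M * r⁻¹ ^ 3) * ‖u y‖ₑ) y := by
  by_cases hy : y ∈ ball x (2 * r)
  · rw [indicator_of_mem hy, enorm_mul, Real.enorm_eq_ofReal_abs, Real.enorm_eq_ofReal_abs,
      ← ofReal_norm (u y), mul_comm]
    exact mul_le_mul' (ENNReal.ofReal_le_ofReal (hM hr _)) (ENNReal.ofReal_le_ofReal (abs_locVel_le u x r m y))
  · rw [indicator_of_notMem hy]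
    rw [mem_ball, dist_eq_norm, norm_sub_rev, not_lt] at hy
    have hgt : r < ‖x - y‖ := lt_of_lt_of_le (by linarith) hy
    rw [newtonFarLaplacian_eq_zero_of_gt (half_pos hr).le (half_lt_self hr) hgt, mul_zero, enorm_zero]

/-! ### The two terms of the local representation -/

/-- **The gradient-potential term**: for smooth `u`,
`‖∂ⱼN[W_b](x)‖ ≤ C₁ ∫_{B(x,r)} |x − y|⁻² ‖curl u(y)‖ dy` (`∂ⱼN[W_b] = ∫ ∂ⱼΓ₀(x − y) W_b(y) dy`,
`fderiv_newtonNearPotential_eq_newtonNearGradPotential`). [folklore] -/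
theorem enorm_fderiv_newtonNearPotential_locVort_le {C₁ : ℝ} (hC₁0 : 0 ≤ C₁)
    (hC₁ : ∀ ⦃r : ℝ⦄, 0 < r → ∀ a z : (EuclideanSpace ℝ (Fin 3)), |newtonNearGrad (r / 2) r a z| ≤ C₁ * ‖a‖ * ‖z‖ ^ (-(2 : ℝ)))
    {u : (EuclideanSpace ℝ (Fin 3)) → (EuclideanSpace ℝ (Fin 3))} (hu : ContDiff ℝ ∞ u) {r : ℝ} (hr : 0 < r) (x : (EuclideanSpace ℝ (Fin 3))) (j b : Fin 3) :
    ‖fderiv ℝ (newtonNearPotential (r / 2) r (locVort u x r b)) x (EuclideanSpace.single j (1 : ℝ))‖ₑ ≤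
      ENNReal.ofReal C₁ * ∫⁻ y in ball x r, ENNReal.ofReal (‖x - y‖ ^ (-(2 : ℝ))) * ‖curl u y‖ₑ := by
  rw [fderiv_newtonNearPotential_eq_newtonNearGradPotential (half_pos hr) (half_lt_self hr)
    (contDiff_locVort hu x r b (n := 1)) (hasCompactSupport_locVort hr u b) x (EuclideanSpace.single j (1 : ℝ))]
  unfold newtonNearGradPotential
  calc ‖∫ y, newtonNearGrad (r / 2) r (EuclideanSpace.single j (1 : ℝ)) (x - y) • locVort u x r b y‖ₑ
      ≤ ∫⁻ y, ‖newtonNearGrad (r / 2) r (EuclideanSpace.single j (1 : ℝ)) (x - y) • locVort u x r b y‖ₑ :=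
        enorm_integral_le_lintegral_enorm _
    _ ≤ ∫⁻ y, (ball x r).indicator
          (fun y => ENNReal.ofReal (C₁ * ‖x - y‖ ^ (-(2 : ℝ))) * ‖curl u y‖ₑ) y :=
        lintegral_mono fun y => enorm_newtonNearGrad_smul_locVort_le hC₁ u hr x j b y
    _ = ∫⁻ y in ball x r, ENNReal.ofReal (C₁ * ‖x - y‖ ^ (-(2 : ℝ))) * ‖curl u y‖ₑ :=
        lintegral_indicator measurableSet_ball _
    _ = ENNReal.ofReal C₁ * ∫⁻ y in ball x r, ENNReal.ofReal (‖x - y‖ ^ (-(2 : ℝ))) * ‖curl u y‖ₑ := by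
        rw [← lintegral_const_mul' _ _ ENNReal.ofReal_ne_top]
        refine lintegral_congr fun y => ?_
        rw [ENNReal.ofReal_mul hC₁0, mul_assoc]

/-- **The smoothing term**: `‖Λ[Φₘ](x)‖ ≤ M r⁻³ ∫_{B(x,2r)} ‖u(y)‖ dy`
(`Λ[Φₘ](x) = ∫ Φₘ(y) λ_r(x − y) dy`, `newtonFarSmoothing_eq_integral_kernel`). [folklore] -/
theorem enorm_newtonFarSmoothing_locVel_le {M : ℝ}
    (hM : ∀ ⦃r : ℝ⦄, 0 < r → ∀ z : (EuclideanSpace ℝ (Fin 3)), |newtonFarLaplacian (r / 2) r z| ≤ M * r⁻¹ ^ 3)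
    (u : (EuclideanSpace ℝ (Fin 3)) → (EuclideanSpace ℝ (Fin 3))) {r : ℝ} (hr : 0 < r) (x : (EuclideanSpace ℝ (Fin 3))) (m : Fin 3) :
    ‖newtonFarSmoothing (r / 2) r (locVel u x r m) x‖ₑ ≤
      ENNReal.ofReal (M * r⁻¹ ^ 3) * ∫⁻ y in ball x (2 * r), ‖u y‖ₑ := by
  rw [newtonFarSmoothing_eq_integral_kernel]
  calc ‖∫ y, locVel u x r m y * newtonFarLaplacian (r / 2) r (x - y)‖ₑ
      ≤ ∫⁻ y, ‖locVel u x r m y * newtonFarLaplacian (r / 2) r (x - y)‖ₑ :=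
        enorm_integral_le_lintegral_enorm _
    _ ≤ ∫⁻ y, (ball x (2 * r)).indicator (fun y => ENNReal.ofReal (M * r⁻¹ ^ 3) * ‖u y‖ₑ) y :=
        lintegral_mono fun y => enorm_locVel_mul_newtonFarLaplacian_le hM u hr x m y
    _ = ∫⁻ y in ball x (2 * r), ENNReal.ofReal (M * r⁻¹ ^ 3) * ‖u y‖ₑ :=
        lintegral_indicator measurableSet_ball _
    _ = ENNReal.ofReal (M * r⁻¹ ^ 3) * ∫⁻ y in ball x (2 * r), ‖u y‖ₑ :=
        lintegral_const_mul' _ _ ENNReal.ofReal_ne_top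

/-! ### The scale-free Biot–Savart bound -/

/-- **Local Biot–Savart bound, zeroth order, uniform in the scale.** There is an absolute
constant `C` such that for every smooth divergence-free `u : (EuclideanSpace ℝ (Fin 3)) → (EuclideanSpace ℝ (Fin 3))`, every point `x` and every
radius `r > 0`,
`‖u(x)‖ ≤ C ∫_{B(x,r)} |x − y|⁻² ‖curl u(y)‖ dy + C r⁻³ ∫_{B(x,2r)} ‖u(y)‖ dy`
(in `ℝ≥0∞`). Proof: on `B(x, r)` the local Biot–Savart law of the tree
(`eqOn_coord_localRep`, Tao 2011 §10 / Gilbarg–Trudinger (2.17)) writes each component `uₘ` as a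
difference of first derivatives of truncated Newtonian potentials of the localised vorticity plus
the smoothing `Λ[ψuₘ]`; the two preceding estimates bound these, and `‖u‖ ≤ Σₘ |uₘ|`.
[cite: WangYang2026, Lemma 2.3 (i) (2.7), p. 8] -/
theorem exists_enorm_le_lintegral_curl_add :
    ∃ C : ℝ≥0, ∀ ⦃u : (EuclideanSpace ℝ (Fin 3)) → (EuclideanSpace ℝ (Fin 3))⦄, ContDiff ℝ ∞ u → VectorCalculus.IsDivFree u →
      ∀ (x : (EuclideanSpace ℝ (Fin 3))) ⦃r : ℝ⦄, 0 < r →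
        ‖u x‖ₑ ≤ C * (∫⁻ y in ball x r, ENNReal.ofReal (‖x - y‖ ^ (-(2 : ℝ))) * ‖curl u y‖ₑ) +
          C * ENNReal.ofReal (r⁻¹ ^ 3) * ∫⁻ y in ball x (2 * r), ‖u y‖ₑ := by
  obtain ⟨C₁, hC₁0, hC₁⟩ := abs_newtonNearGrad_half_le
  obtain ⟨M, hM0, hM⟩ := abs_newtonFarLaplacian_half_le
  refine ⟨(6 * C₁ + 3 * M).toNNReal, fun u hu hdiv x r hr => ?_⟩
  have hK : ((6 * C₁ + 3 * M).toNNReal : ℝ≥0∞) = ENNReal.ofReal (6 * C₁ + 3 * M) := rfl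
  rw [hK]
  set I : ℝ≥0∞ := ∫⁻ y in ball x r, ENNReal.ofReal (‖x - y‖ ^ (-(2 : ℝ))) * ‖curl u y‖ₑ with hI
  set J : ℝ≥0∞ := ∫⁻ y in ball x (2 * r), ‖u y‖ₑ with hJ
  set A : ℝ≥0∞ := ENNReal.ofReal C₁ with hA
  set B : ℝ≥0∞ := ENNReal.ofReal M with hB
  set R : ℝ≥0∞ := ENNReal.ofReal (r⁻¹ ^ 3) with hR
  have hBR : ENNReal.ofReal (M * r⁻¹ ^ 3) = B * R := by rw [hB, hR, ENNReal.ofReal_mul hM0]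
  -- each component
  have hcomp : ∀ m : Fin 3, ‖u x m‖ₑ ≤ 2 * (A * I) + B * R * J := by
    intro m
    have hrep : u x m = localRep u x r m x := eqOn_coord_localRep hu hdiv hr m (mem_ball_self hr)
    rw [hrep, localRep]
    calc ‖-(fderiv ℝ (newtonNearPotential (r / 2) r (locVort u x r (succIdx₂ m))) x (EuclideanSpace.single (succIdx m) (1 : ℝ)) -
            fderiv ℝ (newtonNearPotential (r / 2) r (locVort u x r (succIdx m))) x (EuclideanSpace.single (succIdx₂ m) (1 : ℝ))) +
          newtonFarSmoothing (r / 2) r (locVel u x r m) x‖ₑ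
        ≤ ‖-(fderiv ℝ (newtonNearPotential (r / 2) r (locVort u x r (succIdx₂ m))) x (EuclideanSpace.single (succIdx m) (1 : ℝ)) -
            fderiv ℝ (newtonNearPotential (r / 2) r (locVort u x r (succIdx m))) x (EuclideanSpace.single (succIdx₂ m) (1 : ℝ)))‖ₑ +
          ‖newtonFarSmoothing (r / 2) r (locVel u x r m) x‖ₑ := enorm_add_le _ _
      _ ≤ (‖fderiv ℝ (newtonNearPotential (r / 2) r (locVort u x r (succIdx₂ m))) x (EuclideanSpace.single (succIdx m) (1 : ℝ))‖ₑ +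
            ‖fderiv ℝ (newtonNearPotential (r / 2) r (locVort u x r (succIdx m))) x (EuclideanSpace.single (succIdx₂ m) (1 : ℝ))‖ₑ) +
          ‖newtonFarSmoothing (r / 2) r (locVel u x r m) x‖ₑ := by
          gcongr
          rw [enorm_neg]
          exact enorm_sub_le
      _ ≤ (A * I + A * I) + ENNReal.ofReal (M * r⁻¹ ^ 3) * J := by
          gcongr
          · exact enorm_fderiv_newtonNearPotential_locVort_le hC₁0 hC₁ hu hr x _ _
          · exact enorm_fderiv_newtonNearPotential_locVort_le hC₁0 hC₁ hu hr x _ _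
          · exact enorm_newtonFarSmoothing_locVel_le hM u hr x m
      _ = 2 * (A * I) + B * R * J := by rw [two_mul, hBR]
  -- sum over the components
  have hsum : ‖u x‖ₑ ≤ ∑ m : Fin 3, ‖u x m‖ₑ := by
    rw [← ofReal_norm]
    calc ENNReal.ofReal ‖u x‖ ≤ ENNReal.ofReal (∑ m : Fin 3, |u x m|) :=
          ENNReal.ofReal_le_ofReal (norm_le_sum_abs_coord (u x))
      _ = ∑ m : Fin 3, ‖u x m‖ₑ := by
          rw [ENNReal.ofReal_sum_of_nonneg fun m _ => abs_nonneg _]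
          refine Finset.sum_congr rfl fun m _ => ?_
          rw [Real.enorm_eq_ofReal_abs]
  have h6 : 6 * A ≤ ENNReal.ofReal (6 * C₁ + 3 * M) := by
    rw [hA, ← ENNReal.ofReal_ofNat, ← ENNReal.ofReal_mul (by norm_num)]
    exact ENNReal.ofReal_le_ofReal (by linarith)
  have h3 : 3 * B ≤ ENNReal.ofReal (6 * C₁ + 3 * M) := by
    rw [hB, ← ENNReal.ofReal_ofNat, ← ENNReal.ofReal_mul (by norm_num)]
    exact ENNReal.ofReal_le_ofReal (by linarith)
  calc ‖u x‖ₑ ≤ ∑ m : Fin 3, ‖u x m‖ₑ := hsum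
    _ ≤ ∑ _m : Fin 3, (2 * (A * I) + B * R * J) := Finset.sum_le_sum fun m _ => hcomp m
    _ = 3 * (2 * (A * I) + B * R * J) := by
        rw [Finset.sum_const, Finset.card_univ, Fintype.card_fin, nsmul_eq_mul, Nat.cast_ofNat]
    _ = (6 * A) * I + (3 * B) * R * J := by ring
    _ ≤ ENNReal.ofReal (6 * C₁ + 3 * M) * I + ENNReal.ofReal (6 * C₁ + 3 * M) * R * J := by
        gcongr

/-! ### Letting the radius tend to infinity -/

/-- A pointwise majorant for a field that is small off a ball: if `‖u‖ ≤ B` on `B̄(0, s)` and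
`‖u‖ ≤ δ` off it, then `‖u(y)‖ ≤ 1_{B̄(0,s)}(y) B + δ`. [folklore] -/
theorem enorm_le_indicator_add {u : (EuclideanSpace ℝ (Fin 3)) → (EuclideanSpace ℝ (Fin 3))} {s B δ : ℝ} (hB : ∀ y ∈ closedBall (0 : EuclideanSpace ℝ (Fin 3)) s, ‖u y‖ ≤ B)
    (hδ : ∀ y, y ∈ (closedBall (0 : EuclideanSpace ℝ (Fin 3)) s)ᶜ → ‖u y‖ ≤ δ) (y : (EuclideanSpace ℝ (Fin 3))) :
    ‖u y‖ₑ ≤ (closedBall (0 : EuclideanSpace ℝ (Fin 3)) s).indicator (fun _ => ENNReal.ofReal B) y + ENNReal.ofReal δ := by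
  rw [← ofReal_norm]
  by_cases hy : y ∈ closedBall (0 : EuclideanSpace ℝ (Fin 3)) s
  · rw [indicator_of_mem hy]
    exact (ENNReal.ofReal_le_ofReal (hB y hy)).trans le_self_add
  · rw [indicator_of_notMem hy, zero_add]
    exact ENNReal.ofReal_le_ofReal (hδ y hy)

/-- **Uniform decay kills the averaged term**: if `u` is continuous and `u(y) → 0` as
`|y| → ∞`, then `r⁻³ ∫_{B(x,2r)} ‖u‖ → 0` as `r → ∞` (split `B(x, 2r)` into `B̄(0, s)`, where
`u` is bounded, and its complement, where `‖u‖ ≤ δ`; `|B(x, 2r)| = 8|B₁| r³`). [folklore] -/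
theorem tendsto_lintegral_ball_of_tendsto_cocompact {u : (EuclideanSpace ℝ (Fin 3)) → (EuclideanSpace ℝ (Fin 3))} (hu : Continuous u)
    (h0 : Tendsto u (cocompact (EuclideanSpace ℝ (Fin 3))) (𝓝 0)) (x : (EuclideanSpace ℝ (Fin 3))) :
    Tendsto (fun r : ℝ => ENNReal.ofReal (r⁻¹ ^ 3) * ∫⁻ y in ball x (2 * r), ‖u y‖ₑ)
      atTop (𝓝 0) := by
  set V : ℝ≥0∞ := volume (ball (0 : EuclideanSpace ℝ (Fin 3)) 1) with hV
  have hVtop : V ≠ ⊤ := measure_ball_lt_top.ne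
  have hball : ∀ r : ℝ, 0 < r → volume (ball x (2 * r)) = ENNReal.ofReal ((2 * r) ^ 3) * V := by
    intro r hr
    rw [hV, Measure.addHaar_ball_of_pos volume x (by positivity : (0 : ℝ) < 2 * r),
      finrank_euclideanSpace_fin]
  -- the scale factor tends to `0`
  have hsc : Tendsto (fun r : ℝ => ENNReal.ofReal (r⁻¹ ^ 3)) atTop (𝓝 0) := by
    have h : Tendsto (fun r : ℝ => r⁻¹ ^ 3) atTop (𝓝 0) := by
      simpa using (tendsto_inv_atTop_zero (𝕜 := ℝ)).pow 3
    simpa using ENNReal.tendsto_ofReal h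
  refine ENNReal.tendsto_nhds_zero.2 fun ε hε => ?_
  rcases eq_or_ne ε ⊤ with hεtop | hεtop
  · exact Eventually.of_forall fun r => by rw [hεtop]; exact le_top
  -- `δ > 0` with `8 δ |B₁| ≤ ε / 2`
  have hεr : 0 < ε.toReal := ENNReal.toReal_pos hε.ne' hεtop
  have hV0 : 0 ≤ V.toReal := ENNReal.toReal_nonneg
  set δ : ℝ := ε.toReal / 2 / (8 * (V.toReal + 1)) with hδ
  have hδ0 : 0 < δ := by positivity
  have hδV : ENNReal.ofReal (8 * δ) * V ≤ ε / 2 := by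
    have h1 : 8 * δ * V.toReal ≤ ε.toReal / 2 := by
      have e : 8 * δ * V.toReal = ε.toReal / 2 * (V.toReal / (V.toReal + 1)) := by
        rw [hδ]; field_simp
      rw [e]
      have h2 : V.toReal / (V.toReal + 1) ≤ 1 := by
        rw [div_le_one (by positivity)]; linarith
      calc ε.toReal / 2 * (V.toReal / (V.toReal + 1)) ≤ ε.toReal / 2 * 1 := by gcongr
        _ = ε.toReal / 2 := mul_one _
    calc ENNReal.ofReal (8 * δ) * V = ENNReal.ofReal (8 * δ) * ENNReal.ofReal V.toReal := by
          rw [ENNReal.ofReal_toReal hVtop]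
      _ = ENNReal.ofReal (8 * δ * V.toReal) := by rw [← ENNReal.ofReal_mul (by positivity)]
      _ ≤ ENNReal.ofReal (ε.toReal / 2) := ENNReal.ofReal_le_ofReal h1
      _ = ε / 2 := by
          rw [ENNReal.ofReal_div_of_pos two_pos, ENNReal.ofReal_toReal hεtop, ENNReal.ofReal_ofNat]
  -- decay: `‖u y‖ < δ` off a closed ball `B̄(0, s)`; a bound `B` on it
  have hdec : ∀ᶠ y in Bornology.cobounded (EuclideanSpace ℝ (Fin 3)), ‖u y‖ < δ := by
    rw [Metric.cobounded_eq_cocompact]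
    have h := h0.norm
    rw [norm_zero] at h
    exact h (Iio_mem_nhds hδ0)
  obtain ⟨s, -, hs⟩ := (Metric.hasBasis_cobounded_compl_closedBall (0 : EuclideanSpace ℝ (Fin 3))).eventually_iff.1 hdec
  obtain ⟨B, hB⟩ := (isCompact_closedBall (0 : EuclideanSpace ℝ (Fin 3)) s).exists_bound_of_continuousOn hu.continuousOn
  have hK : ENNReal.ofReal B * volume (closedBall (0 : EuclideanSpace ℝ (Fin 3)) s) ≠ ⊤ :=
    ENNReal.mul_ne_top ENNReal.ofReal_ne_top measure_closedBall_lt_top.ne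
  -- the bound for every `r > 0`
  have hbound : ∀ r : ℝ, 0 < r →
      ENNReal.ofReal (r⁻¹ ^ 3) * ∫⁻ y in ball x (2 * r), ‖u y‖ₑ ≤
        ENNReal.ofReal (r⁻¹ ^ 3) * (ENNReal.ofReal B * volume (closedBall (0 : EuclideanSpace ℝ (Fin 3)) s)) + ε / 2 := by
    intro r hr
    have hpt : ∀ y, ‖u y‖ₑ ≤
        (closedBall (0 : EuclideanSpace ℝ (Fin 3)) s).indicator (fun _ => ENNReal.ofReal B) y + ENNReal.ofReal δ :=
      enorm_le_indicator_add hB (fun y hy => (hs hy).le)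
    have h1 : ∫⁻ y in ball x (2 * r), ‖u y‖ₑ ≤
        ENNReal.ofReal B * volume (closedBall (0 : EuclideanSpace ℝ (Fin 3)) s) +
          ENNReal.ofReal δ * volume (ball x (2 * r)) := by
      calc ∫⁻ y in ball x (2 * r), ‖u y‖ₑ
          ≤ ∫⁻ y in ball x (2 * r), ((closedBall (0 : EuclideanSpace ℝ (Fin 3)) s).indicator (fun _ => ENNReal.ofReal B) y +
              ENNReal.ofReal δ) := lintegral_mono fun y => hpt y
        _ = (∫⁻ y in ball x (2 * r), (closedBall (0 : EuclideanSpace ℝ (Fin 3)) s).indicator (fun _ => ENNReal.ofReal B) y) +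
              ENNReal.ofReal δ * volume (ball x (2 * r)) := by
            rw [lintegral_add_right _ measurable_const, setLIntegral_const]
        _ ≤ (∫⁻ y, (closedBall (0 : EuclideanSpace ℝ (Fin 3)) s).indicator (fun _ => ENNReal.ofReal B) y) +
              ENNReal.ofReal δ * volume (ball x (2 * r)) := by
            gcongr
            exact Measure.restrict_le_self
        _ = ENNReal.ofReal B * volume (closedBall (0 : EuclideanSpace ℝ (Fin 3)) s) +
              ENNReal.ofReal δ * volume (ball x (2 * r)) := by
            rw [lintegral_indicator measurableSet_closedBall, setLIntegral_const]
    have h2 : ENNReal.ofReal (r⁻¹ ^ 3) * (ENNReal.ofReal δ * volume (ball x (2 * r))) =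
        ENNReal.ofReal (8 * δ) * V := by
      rw [hball r hr]
      calc ENNReal.ofReal (r⁻¹ ^ 3) * (ENNReal.ofReal δ * (ENNReal.ofReal ((2 * r) ^ 3) * V))
          = ENNReal.ofReal (r⁻¹ ^ 3) * ENNReal.ofReal δ * ENNReal.ofReal ((2 * r) ^ 3) * V := by ring
        _ = ENNReal.ofReal (r⁻¹ ^ 3 * δ * (2 * r) ^ 3) * V := by
            rw [ENNReal.ofReal_mul (by positivity), ENNReal.ofReal_mul (by positivity)]
        _ = ENNReal.ofReal (8 * δ) * V := by
            congr 2
            field_simp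
            ring
    calc ENNReal.ofReal (r⁻¹ ^ 3) * ∫⁻ y in ball x (2 * r), ‖u y‖ₑ
        ≤ ENNReal.ofReal (r⁻¹ ^ 3) * (ENNReal.ofReal B * volume (closedBall (0 : EuclideanSpace ℝ (Fin 3)) s) +
            ENNReal.ofReal δ * volume (ball x (2 * r))) := by gcongr
      _ = ENNReal.ofReal (r⁻¹ ^ 3) * (ENNReal.ofReal B * volume (closedBall (0 : EuclideanSpace ℝ (Fin 3)) s)) +
            ENNReal.ofReal (8 * δ) * V := by rw [mul_add, h2]
      _ ≤ _ := add_le_add le_rfl hδV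
  -- the first term tends to zero
  have ht1 : Tendsto (fun r : ℝ =>
      ENNReal.ofReal (r⁻¹ ^ 3) * (ENNReal.ofReal B * volume (closedBall (0 : EuclideanSpace ℝ (Fin 3)) s))) atTop (𝓝 0) := by
    have h := ENNReal.Tendsto.mul_const hsc (Or.inr hK) (b := ENNReal.ofReal B * volume (closedBall (0 : EuclideanSpace ℝ (Fin 3)) s))
    rwa [zero_mul] at h
  have hε2 : 0 < ε / 2 := ENNReal.half_pos hε.ne'
  filter_upwards [ENNReal.tendsto_nhds_zero.1 ht1 (ε / 2) hε2, eventually_gt_atTop (0 : ℝ)] with r hr1 hr0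
  calc _ ≤ ENNReal.ofReal (r⁻¹ ^ 3) * (ENNReal.ofReal B * volume (closedBall (0 : EuclideanSpace ℝ (Fin 3)) s)) + ε / 2 :=
        hbound r hr0
    _ ≤ ε / 2 + ε / 2 := add_le_add hr1 le_rfl
    _ = ε := ENNReal.add_halves ε

/-- **Wang–Yang's Biot–Savart bound (2.7), for every smooth divergence-free field vanishing at
infinity**: there is an absolute constant `C` such that
`‖u(x)‖ ≤ C ∫_{(EuclideanSpace ℝ (Fin 3))} |x − y|⁻² ‖curl u(y)‖ dy` (in `ℝ≥0∞`; the right side may be infinite) for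
every smooth divergence-free `u : (EuclideanSpace ℝ (Fin 3)) → (EuclideanSpace ℝ (Fin 3))` with `u(y) → 0` as `|y| → ∞` and every `x`. In print
this is stated for `D`-solutions, whose Biot–Savart representation is derived from
`u, curl (−Δ)⁻¹ω ∈ L⁶`; here `r → ∞` in `exists_enorm_le_lintegral_curl_add`, the averaged
term vanishing in the limit by `tendsto_lintegral_ball_of_tendsto_cocompact`.
[cite: WangYang2026, Lemma 2.3 (i) (2.7), p. 8] -/
theorem exists_enorm_le_lintegral_curl_of_tendsto :
    ∃ C : ℝ≥0, ∀ ⦃u : (EuclideanSpace ℝ (Fin 3)) → (EuclideanSpace ℝ (Fin 3))⦄, ContDiff ℝ ∞ u → VectorCalculus.IsDivFree u →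
      Tendsto u (cocompact (EuclideanSpace ℝ (Fin 3))) (𝓝 0) → ∀ x : (EuclideanSpace ℝ (Fin 3)),
        ‖u x‖ₑ ≤ C * ∫⁻ y, ENNReal.ofReal (‖x - y‖ ^ (-(2 : ℝ))) * ‖curl u y‖ₑ := by
  obtain ⟨C, hC⟩ := exists_enorm_le_lintegral_curl_add
  refine ⟨C, fun u hu hdiv h0 x => ?_⟩
  set I : ℝ≥0∞ := ∫⁻ y, ENNReal.ofReal (‖x - y‖ ^ (-(2 : ℝ))) * ‖curl u y‖ₑ with hI
  have htail := tendsto_lintegral_ball_of_tendsto_cocompact hu.continuous h0 x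
  have htail' : Tendsto (fun r : ℝ =>
      (C : ℝ≥0∞) * (ENNReal.ofReal (r⁻¹ ^ 3) * ∫⁻ y in ball x (2 * r), ‖u y‖ₑ)) atTop (𝓝 0) := by
    have h := ENNReal.Tendsto.const_mul htail (Or.inr ENNReal.coe_ne_top) (a := (C : ℝ≥0∞))
    rwa [mul_zero] at h
  refine ENNReal.le_of_forall_pos_le_add fun ε hε _ => ?_
  have hε' : (0 : ℝ≥0∞) < ε := by exact_mod_cast hε
  obtain ⟨r, hr, hr0⟩ :=
    ((ENNReal.tendsto_nhds_zero.1 htail' ε hε').and (eventually_gt_atTop 0)).exists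
  have h1 : (C : ℝ≥0∞) * ∫⁻ y in ball x r, ENNReal.ofReal (‖x - y‖ ^ (-(2 : ℝ))) * ‖curl u y‖ₑ ≤ C * I := by
    rw [hI]
    gcongr
    exact Measure.restrict_le_self
  have h2 : (C : ℝ≥0∞) * ENNReal.ofReal (r⁻¹ ^ 3) * ∫⁻ y in ball x (2 * r), ‖u y‖ₑ ≤ ε := by
    rw [mul_assoc]; exact hr
  calc ‖u x‖ₑ ≤ C * (∫⁻ y in ball x r, ENNReal.ofReal (‖x - y‖ ^ (-(2 : ℝ))) * ‖curl u y‖ₑ) +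
        C * ENNReal.ofReal (r⁻¹ ^ 3) * ∫⁻ y in ball x (2 * r), ‖u y‖ₑ := hC hu hdiv x hr0
    _ ≤ C * I + ε := add_le_add h1 h2

end Literature.Analysis.FluidPDE

end
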